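import Summits.Ventures.Crystal3D.Theorems.StickyWulffConstantGenericWallFloorCapStart
import Summits.Ventures.Crystal3D.Theorems.StickyWulffConstantCoaxialWallLawTwinFrames
import Summits.Ventures.Crystal3D.Theorems.StickyWulffConstantCoaxialWallLawFrame
import Summits.Ventures.Crystal3D.Theorems.StickyWulffConstantGenericWallFloorExitTwinCap
import HarnessLib

/-!
# CAP-START on a moved BARLOW stacking: the walker start states at the layer balls of `L·B(σ) + s₀`
# (crux `GenericWallFloor`, stmt-Ventures-19480, line `WallLedgerG`; the per-top frame convention for lane T, in coordinates)

HONEST FRAMING. Venture `Summits/Ventures/Crystal3D` (cell `crystal3d-full`), helper `--supports` the crux `GenericWallFloor`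
(stmt-Ventures-19480) of `route-Ventures-StickyWulffConstant`, registered line `WallLedgerG`, open stub `stub_twoSlabAdhesion`.
Rung credit only; F-C1 not moved; NOT the stub.  `…CapStart` has the start-side tools for an ABSTRACT half-full / twin-dozen
ball; this file instantiates them on the Literature's Barlow stackings (`barlowPos / barlowLayer / barlowStacking 1 √(2/3) σ`,
bilayer frames `id` / `basalMirror` of `…/BarlowBilayers`) moved by `p ↦ L p + s₀`, inside any `X` containing the moved
stacking sites within distance `1` of the predecessor.  CONVENTION (posted to cf-p1 / wulff-p2, 2026-08-28): predecessor
`p₀ = barlowPos σ k i j` in layer `k`; frame of a `Δ`-bilayer (`σ k = 1`) is `L`, of a `∇`-bilayer (`σ k = −1`) the twin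
`G = twinFrame L (L e₃) = L ∘ basalMirror`; layer normal `n = L e₃`; ONE family per plate, common bottom `⟨L, v, 0⟩`, `v` an
upper model slot (`v₂ = √(2/3)`) with `L v` steep.
* bookkeeping: `fccLayer_add_slot_mem`, `barlow_delta_add_slot_mem` / `barlow_nabla_add_slot_mem` (the nine non-negative
  slots of the bilayer frame land in the bilayer), `barlow_delta_sub_slot_mem` / `barlow_nabla_sub_slot_mem` (lower triangle
  in layer `k−1` over a same-sign step), `barlowLayer_sub_two_normal` (h-layer: layer `k+1` lowered by two spacings is layer
  `k−1`), `twinFrame_axis_apply`.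
* **`walkInv_capStart_barlow`** (`σ k = 1`): `(L p₀ + s₀ + L v, [⟨L, v, 0⟩])` satisfies `WalkInv`; strong certificate
  `walkCertified12_capStart_barlow_cc / _hc` (layer below: `σ (k−1) = 1` full dozen / `= −1` twin dozen).
* **`walkInv_capStart₂_barlow`** (`σ k = −1`): `(L p₀ + s₀ + G q, [⟨G, q, L e₃⟩, ⟨L, v, 0⟩])`, `q = bestCapper G (L e₃) z`,
  satisfies `WalkInv ∧ StackWF`; `walkCertified12_capStart₂_barlow_cc / _hc`.
WHAT THIS IS NOT: not the stub; no flux count, no Barlow sealing; `ExactOnly` (C12-55) stays an input BY NAME; F-C1 not moved.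
-/

noncomputable section

namespace Summit.Ventures.Crystal3D.Theorems

open Finset
open Literature.MathematicalPhysics.StatisticalMechanics
open scoped InnerProductSpace

variable {X : Finset (EuclideanSpace ℝ (Fin 3))}

/-! ### Model bookkeeping: slots move between adjacent layers -/

/-- The layer spacing `√(2/3)` is nonzero. -/
private theorem sqrt_twoThirds_ne_zero' : Real.sqrt (2 / 3) ≠ 0 := (Real.sqrt_pos.2 (by norm_num)).ne'
/-- A layer of a stacking is part of the stacking. -/
theorem barlowLayer_subset_stacking (σ : ℤ → ℤ) (k : ℤ) :
    barlowLayer 1 (Real.sqrt (2 / 3)) σ k ⊆ barlowStacking 1 (Real.sqrt (2 / 3)) σ := by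
  rintro x ⟨i, j, rfl⟩; exact barlowPos_mem k i j

/-- **fcc layer plus slot.**  For `q` in fcc layer `m` and a slot `w`: `q + w` lies in fcc layer `m` if `w₂ = 0`, in layer
`m + 1` if `w₂ = √(2/3)`, in layer `m − 1` if `w₂ = −√(2/3)`. -/
theorem fccLayer_add_slot_mem {q w : EuclideanSpace ℝ (Fin 3)} {m : ℤ}
    (hq : q ∈ barlowLayer 1 (Real.sqrt (2 / 3)) constHagg m) (hw : w ∈ fccSlots) :
    (w 2 = 0 → q + w ∈ barlowLayer 1 (Real.sqrt (2 / 3)) constHagg m) ∧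
    (w 2 = Real.sqrt (2 / 3) → q + w ∈ barlowLayer 1 (Real.sqrt (2 / 3)) constHagg (m + 1)) ∧
    (w 2 = -Real.sqrt (2 / 3) → q + w ∈ barlowLayer 1 (Real.sqrt (2 / 3)) constHagg (m - 1)) := by
  have hqS : q ∈ fccStacking 1 (Real.sqrt (2 / 3)) := barlowLayer_subset_stacking constHagg m hq
  have hq2 : q 2 = m * Real.sqrt (2 / 3) :=
    (mem_barlowLayer_iff_apply_two sqrt_twoThirds_ne_zero' hqS m).1 hq
  have hsum : q + w ∈ fccStacking 1 (Real.sqrt (2 / 3)) := fcc_add_site_mem hqS (mem_fcc_of_mem_fccSlots hw)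
  have h2 : (q + w) 2 = q 2 + w 2 := by simp
  refine ⟨fun h0 => ?_, fun hp => ?_, fun hn => ?_⟩
  · exact (mem_barlowLayer_iff_apply_two sqrt_twoThirds_ne_zero' hsum m).2 (by rw [h2, hq2, h0, add_zero])
  · exact (mem_barlowLayer_iff_apply_two sqrt_twoThirds_ne_zero' hsum (m + 1)).2
      (by rw [h2, hq2, hp]; push_cast; ring)
  · exact (mem_barlowLayer_iff_apply_two sqrt_twoThirds_ne_zero' hsum (m - 1)).2
      (by rw [h2, hq2, hn]; push_cast; ring)

/-- **Δ-bilayer: the nine non-negative slots land in the bilayer.**  If `σ k = 1`, then for every slot `w` with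
`w₂ ≥ 0` the point `barlowPos σ k i j + w` lies in layer `k` or layer `k + 1`. -/
theorem barlow_delta_add_slot_mem (σ : ℤ → ℤ) (k i j : ℤ) (hk : σ k = 1) {w : EuclideanSpace ℝ (Fin 3)}
    (hw : w ∈ fccSlots) (h0 : 0 ≤ w 2) :
    barlowPos 1 (Real.sqrt (2 / 3)) σ k i j + w ∈
      barlowLayer 1 (Real.sqrt (2 / 3)) σ k ∪ barlowLayer 1 (Real.sqrt (2 / 3)) σ (k + 1) := by
  have hrpos : 0 < Real.sqrt (2 / 3) := Real.sqrt_pos.2 (by norm_num)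
  obtain ⟨hLk, hLk1⟩ := barlowBilayer_eq_translate_fcc_of_eq_one 1 (Real.sqrt (2 / 3)) σ k hk
  have hq : barlowPos 1 (Real.sqrt (2 / 3)) constHagg k i j ∈ barlowLayer 1 (Real.sqrt (2 / 3)) constHagg k := ⟨i, j, rfl⟩
  obtain ⟨h0c, hpc, hnc⟩ := fccLayer_add_slot_mem hq hw
  rw [barlowPos_eq_translate_fcc 1 (Real.sqrt (2 / 3)) σ k i j]
  rcases slot_apply_two_cases hw with h | h | h
  · left; rw [hLk]; exact ⟨_, h0c h, by beta_reduce; abel⟩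
  · right; rw [hLk1]; exact ⟨_, hpc h, by beta_reduce; abel⟩
  · rw [h] at h0; linarith

/-- **Δ-bilayer over a c-layer: the lower triangle lands in layer `k − 1`.**  If `σ k = 1` and `σ (k−1) = 1`, then for
every slot `w` with `w₂ = −√(2/3)` the point `barlowPos σ k i j + w` lies in layer `k − 1`. -/
theorem barlow_delta_sub_slot_mem (σ : ℤ → ℤ) (k i j : ℤ) (hk' : σ (k - 1) = 1) {w : EuclideanSpace ℝ (Fin 3)}
    (hw : w ∈ fccSlots) (hn : w 2 = -Real.sqrt (2 / 3)) :
    barlowPos 1 (Real.sqrt (2 / 3)) σ k i j + w ∈ barlowLayer 1 (Real.sqrt (2 / 3)) σ (k - 1) := by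
  have hlab : (haggLabel σ (k - 1) : ℝ) - ((k - 1 : ℤ) : ℝ) = (haggLabel σ k : ℝ) - k := by
    have := haggLabel_succ σ (k - 1)
    rw [sub_add_cancel, hk'] at this
    rw [this]; push_cast; ring
  have hq : barlowPos 1 (Real.sqrt (2 / 3)) constHagg k i j ∈ barlowLayer 1 (Real.sqrt (2 / 3)) constHagg k := ⟨i, j, rfl⟩
  obtain ⟨-, -, hnc⟩ := fccLayer_add_slot_mem hq hw
  rw [barlowPos_eq_translate_fcc 1 (Real.sqrt (2 / 3)) σ k i j, barlowLayer_eq_translate_fcc 1 (Real.sqrt (2 / 3)) σ (k - 1),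
    hlab]
  exact ⟨_, hnc hn, by beta_reduce; abel⟩


/-- **h-layer: layer `k + 1` lowered by two spacings is layer `k − 1`.**  If the letters of layers `k + 1` and `k − 1`
agree (`haggLabel σ (k+1) = haggLabel σ (k−1)`, i.e. `σ k + σ (k−1) = 0`), then `x − 2√(2/3)·e₃ ∈ layer (k−1)` for every
`x ∈ layer (k+1)`. -/
theorem barlowLayer_sub_two_normal (σ : ℤ → ℤ) (k : ℤ) (hh : haggLabel σ (k + 1) = haggLabel σ (k - 1))
    {x : EuclideanSpace ℝ (Fin 3)} (hx : x ∈ barlowLayer 1 (Real.sqrt (2 / 3)) σ (k + 1)) :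
    x - (2 * Real.sqrt (2 / 3)) • EuclideanSpace.single (2 : Fin 3) (1 : ℝ) ∈ barlowLayer 1 (Real.sqrt (2 / 3)) σ (k - 1) := by
  obtain ⟨i, j, rfl⟩ := hx
  refine ⟨i, j, ?_⟩
  simp only [barlowPos, hh, layerNormal_eq_smul_single]
  push_cast
  module

/-- The letters two apart agree at an h-layer: `σ k + σ (k − 1) = 0 ⇒ haggLabel σ (k+1) = haggLabel σ (k−1)`. -/
theorem haggLabel_eq_of_hLayer (σ : ℤ → ℤ) (k : ℤ) (h : σ k + σ (k - 1) = 0) :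
    haggLabel σ (k + 1) = haggLabel σ (k - 1) := by
  have h1 := haggLabel_succ σ k
  have h2 := haggLabel_succ σ (k - 1)
  rw [sub_add_cancel] at h2
  omega

/-- **The twin frame across the moved axis is the moved basal mirror**: `twinFrame L (L e₃) w = L (basalMirror w)`. -/
theorem twinFrame_axis_apply (L : EuclideanSpace ℝ (Fin 3) ≃ₗᵢ[ℝ] EuclideanSpace ℝ (Fin 3)) (w : EuclideanSpace ℝ (Fin 3)) :
    twinFrame L (L (EuclideanSpace.single (2 : Fin 3) (1 : ℝ))) w = L (basalMirror w) := by
  have he : ‖EuclideanSpace.single (2 : Fin 3) (1 : ℝ)‖ = 1 := by rw [PiLp.norm_single, norm_one]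
  have hLe : ‖L (EuclideanSpace.single (2 : Fin 3) (1 : ℝ))‖ = 1 := by rw [LinearIsometryEquiv.norm_map, he]
  rw [twinFrame_apply L hLe, basalMirror, reflection_unit_apply he, LinearIsometryEquiv.inner_map_map, map_sub,
    LinearIsometryEquiv.map_smul]

/-- The third coordinate of the basal mirror image: `(basalMirror w)₂ = −w₂`. -/
private theorem basalMirror_apply_two_aux (w : EuclideanSpace ℝ (Fin 3)) : basalMirror w 2 = -w 2 := by rw [basalMirror_apply_coord]; simp

/-- **∇-bilayer: the nine non-negative slots of the twin frame land in the bilayer.**  If `σ k = −1`, then for every slot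
`w` with `w₂ ≤ 0` the point `barlowPos σ k i j + basalMirror w` lies in layer `k` or layer `k + 1`. -/
theorem barlow_nabla_add_slot_mem (σ : ℤ → ℤ) (k i j : ℤ) (hk : σ k = -1) {w : EuclideanSpace ℝ (Fin 3)}
    (hw : w ∈ fccSlots) (h0 : w 2 ≤ 0) :
    barlowPos 1 (Real.sqrt (2 / 3)) σ k i j + basalMirror w ∈
      barlowLayer 1 (Real.sqrt (2 / 3)) σ k ∪ barlowLayer 1 (Real.sqrt (2 / 3)) σ (k + 1) := by
  have hrpos : 0 < Real.sqrt (2 / 3) := Real.sqrt_pos.2 (by norm_num)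
  obtain ⟨hLk, hLk1⟩ := barlowBilayer_eq_mirror_translate_fcc_of_eq_neg_one 1 (Real.sqrt (2 / 3)) σ k hk
  have hq : barlowPos 1 (Real.sqrt (2 / 3)) constHagg (-k) i j ∈ barlowLayer 1 (Real.sqrt (2 / 3)) constHagg (-k) :=
    ⟨i, j, rfl⟩
  obtain ⟨h0c, -, hnc⟩ := fccLayer_add_slot_mem hq hw
  rw [barlowPos_eq_mirror_translate_fcc 1 (Real.sqrt (2 / 3)) σ k i j]
  rcases slot_apply_two_cases hw with h | h | h
  · left; rw [hLk]; exact ⟨_, h0c h, by beta_reduce; rw [map_add]; abel⟩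
  · rw [h] at h0; linarith
  · right; rw [hLk1, show -(k + 1) = -k - 1 by ring]; exact ⟨_, hnc h, by beta_reduce; rw [map_add]; abel⟩

/-- **∇-bilayer over a ∇-step: the lower triangle of the twin frame lands in layer `k − 1`.**  If `σ (k−1) = −1`, then for
every slot `w` with `w₂ = √(2/3)` (so `(basalMirror w)₂ < 0`) the point `barlowPos σ k i j + basalMirror w` lies in layer
`k − 1`. -/
theorem barlow_nabla_sub_slot_mem (σ : ℤ → ℤ) (k i j : ℤ) (hk' : σ (k - 1) = -1) {w : EuclideanSpace ℝ (Fin 3)}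
    (hw : w ∈ fccSlots) (hp : w 2 = Real.sqrt (2 / 3)) :
    barlowPos 1 (Real.sqrt (2 / 3)) σ k i j + basalMirror w ∈ barlowLayer 1 (Real.sqrt (2 / 3)) σ (k - 1) := by
  have hlab : (haggLabel σ (k - 1) : ℝ) + ((k - 1 : ℤ) : ℝ) = (haggLabel σ k : ℝ) + k := by
    have := haggLabel_succ σ (k - 1)
    rw [sub_add_cancel, hk'] at this
    rw [this]; push_cast; ring
  have hq : barlowPos 1 (Real.sqrt (2 / 3)) constHagg (-k) i j ∈ barlowLayer 1 (Real.sqrt (2 / 3)) constHagg (-k) :=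
    ⟨i, j, rfl⟩
  obtain ⟨-, hpc, -⟩ := fccLayer_add_slot_mem hq hw
  rw [barlowPos_eq_mirror_translate_fcc 1 (Real.sqrt (2 / 3)) σ k i j,
    barlowLayer_eq_mirror_translate_fcc 1 (Real.sqrt (2 / 3)) σ (k - 1), hlab, show -(k - 1) = -k + 1 by ring]
  exact ⟨_, hpc hp, by beta_reduce; rw [map_add]; abel⟩

/-! ### The moved plate: start states at the balls of `L·B(σ) + s₀` -/

section Moved

variable (σ : ℤ → ℤ) (L : EuclideanSpace ℝ (Fin 3) ≃ₗᵢ[ℝ] EuclideanSpace ℝ (Fin 3)) (s₀ : EuclideanSpace ℝ (Fin 3))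
  (k i j : ℤ)

/-- Local completeness of the moved plate around the predecessor: every stacking site within distance `1` of
`p₀ = barlowPos σ k i j` is occupied after the motion `p ↦ L p + s₀`. -/
private theorem mem_of_site {σ : ℤ → ℤ} {L : EuclideanSpace ℝ (Fin 3) ≃ₗᵢ[ℝ] EuclideanSpace ℝ (Fin 3)}
    {s₀ : EuclideanSpace ℝ (Fin 3)} {k i j : ℤ}
    (hX : ∀ q ∈ barlowStacking 1 (Real.sqrt (2 / 3)) σ, dist q (barlowPos 1 (Real.sqrt (2 / 3)) σ k i j) ≤ 1 → L q + s₀ ∈ X)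
    {m : ℤ} {d : EuclideanSpace ℝ (Fin 3)} (hd : ‖d‖ ≤ 1)
    (hmem : barlowPos 1 (Real.sqrt (2 / 3)) σ k i j + d ∈ barlowLayer 1 (Real.sqrt (2 / 3)) σ m) :
    L (barlowPos 1 (Real.sqrt (2 / 3)) σ k i j) + s₀ + L d ∈ X := by
  have h := hX _ (barlowLayer_subset_stacking σ m hmem) (by rw [dist_comm, dist_self_add_right]; exact hd)
  rw [map_add] at h
  convert h using 1
  abel

/-- **CAP-START on a Δ-bilayer of a moved Barlow plate.**  `σ k = 1`, `p₀ = barlowPos σ k i j` (layer `k`), the stacking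
sites within distance `1` of `p₀` occupied in `X` after the motion, `v` an upper model slot (`v₂ = √(2/3)`) with `L v`
steep for `z`.  Then the 1-level state `(L p₀ + s₀ + L v, [⟨L, v, 0⟩])` (the walker on layer `k+1`, frame of the bilayer
below it) satisfies `WalkInv`. -/
theorem walkInv_capStart_barlow {z v : EuclideanSpace ℝ (Fin 3)} (hk : σ k = 1)
    (hX : ∀ q ∈ barlowStacking 1 (Real.sqrt (2 / 3)) σ, dist q (barlowPos 1 (Real.sqrt (2 / 3)) σ k i j) ≤ 1 → L q + s₀ ∈ X)
    (hv : v ∈ fccSlots) (hv2 : v 2 = Real.sqrt (2 / 3)) (hsteep : Real.sqrt 2 / 2 ≤ ⟪L v, z⟫_ℝ) :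
    WalkInv X z (L (barlowPos 1 (Real.sqrt (2 / 3)) σ k i j) + s₀ + L v, [⟨L, v, 0⟩]) := by
  have he : ‖EuclideanSpace.single (2 : Fin 3) (1 : ℝ)‖ = 1 := by rw [PiLp.norm_single, norm_one]
  have hn : ‖L (EuclideanSpace.single (2 : Fin 3) (1 : ℝ))‖ = 1 := by rw [LinearIsometryEquiv.norm_map, he]
  have hrpos : 0 < Real.sqrt (2 / 3) := Real.sqrt_pos.2 (by norm_num)
  have hp : L (barlowPos 1 (Real.sqrt (2 / 3)) σ k i j) + s₀ ∈ X := by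
    have := hX _ (barlowPos_mem k i j) (by rw [dist_self]; norm_num)
    exact this
  refine walkInv_capStart L hp hn (fun w hw => ?_) (by rw [inner_frame_axis, hv2]; exact hrpos) (fun w hw h0 => ?_) hv hsteep
  · rw [inner_frame_axis]; exact slot_apply_two_cases hw
  · rw [inner_frame_axis] at h0
    rcases barlow_delta_add_slot_mem σ k i j hk hw h0 with h | h
    · exact mem_of_site hX (by rw [norm_eq_one_of_mem_fccSlots hw]) h
    · exact mem_of_site hX (by rw [norm_eq_one_of_mem_fccSlots hw]) h

/-- **Strong certificate, Δ over c** (`σ k = 1`, `σ (k−1) = 1`: the predecessor carries its full `L`-dozen). -/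
theorem walkCertified12_capStart_barlow_cc {v : EuclideanSpace ℝ (Fin 3)} (hk : σ k = 1) (hk' : σ (k - 1) = 1)
    (hX : ∀ q ∈ barlowStacking 1 (Real.sqrt (2 / 3)) σ, dist q (barlowPos 1 (Real.sqrt (2 / 3)) σ k i j) ≤ 1 → L q + s₀ ∈ X) :
    WalkCertified12 X (L (barlowPos 1 (Real.sqrt (2 / 3)) σ k i j) + s₀ + L v) ⟨L, v, 0⟩ := by
  have hp : L (barlowPos 1 (Real.sqrt (2 / 3)) σ k i j) + s₀ ∈ X := by
    have := hX _ (barlowPos_mem k i j) (by rw [dist_self]; norm_num)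
    exact this
  refine walkCertified12_of_full L hp fun w hw => ?_
  rcases slot_apply_two_cases hw with h | h | h
  · rcases barlow_delta_add_slot_mem σ k i j hk hw h.ge with h' | h'
    · exact mem_of_site hX (by rw [norm_eq_one_of_mem_fccSlots hw]) h'
    · exact mem_of_site hX (by rw [norm_eq_one_of_mem_fccSlots hw]) h'
  · rcases barlow_delta_add_slot_mem σ k i j hk hw (by rw [h]; exact Real.sqrt_nonneg _) with h' | h'
    · exact mem_of_site hX (by rw [norm_eq_one_of_mem_fccSlots hw]) h'
    · exact mem_of_site hX (by rw [norm_eq_one_of_mem_fccSlots hw]) h'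
  · exact mem_of_site hX (by rw [norm_eq_one_of_mem_fccSlots hw]) (barlow_delta_sub_slot_mem σ k i j hk' hw h)

/-- **Strong certificate, Δ over h** (`σ k = 1`, `σ (k−1) = −1`: the predecessor carries its full TWIN dozen — the three
upper slots lowered by two spacings are layer `k − 1`).  Needs `⟪L v, L e₃⟫ > 0`, i.e. `v₂ = √(2/3)`. -/
theorem walkCertified12_capStart_barlow_hc {v : EuclideanSpace ℝ (Fin 3)} (hk : σ k = 1) (hk' : σ (k - 1) = -1)
    (hX : ∀ q ∈ barlowStacking 1 (Real.sqrt (2 / 3)) σ, dist q (barlowPos 1 (Real.sqrt (2 / 3)) σ k i j) ≤ 1 → L q + s₀ ∈ X)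
    (hv2 : v 2 = Real.sqrt (2 / 3)) :
    WalkCertified12 X (L (barlowPos 1 (Real.sqrt (2 / 3)) σ k i j) + s₀ + L v) ⟨L, v, 0⟩ := by
  have he : ‖EuclideanSpace.single (2 : Fin 3) (1 : ℝ)‖ = 1 := by rw [PiLp.norm_single, norm_one]
  have hn : ‖L (EuclideanSpace.single (2 : Fin 3) (1 : ℝ))‖ = 1 := by rw [LinearIsometryEquiv.norm_map, he]
  have hrpos : 0 < Real.sqrt (2 / 3) := Real.sqrt_pos.2 (by norm_num)
  have hp : L (barlowPos 1 (Real.sqrt (2 / 3)) σ k i j) + s₀ ∈ X := by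
    have := hX _ (barlowPos_mem k i j) (by rw [dist_self]; norm_num)
    exact this
  have hlab : haggLabel σ (k + 1) = haggLabel σ (k - 1) := haggLabel_eq_of_hLayer σ k (by rw [hk, hk']; ring)
  refine walkCertified12_of_twinDozen L hn (fun w hw => ?_) (by rw [inner_frame_axis, hv2]; exact hrpos) hp
    (fun w hw h0 => ?_) (fun w hw h0 => ?_)
  · rw [inner_frame_axis]; exact slot_apply_two_cases hw
  · rw [inner_frame_axis] at h0
    rcases barlow_delta_add_slot_mem σ k i j hk hw h0 with h | h
    · exact mem_of_site hX (by rw [norm_eq_one_of_mem_fccSlots hw]) h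
    · exact mem_of_site hX (by rw [norm_eq_one_of_mem_fccSlots hw]) h
  · rw [inner_frame_axis] at h0
    have hw2 : w 2 = Real.sqrt (2 / 3) := by
      rcases slot_apply_two_cases hw with h | h | h
      · rw [h] at h0; exact absurd h0 (lt_irrefl 0)
      · exact h
      · rw [h] at h0; linarith
    -- `p₀ + w` is in layer `k+1`; lowered by two spacings it is in layer `k−1`
    have hup : barlowPos 1 (Real.sqrt (2 / 3)) σ k i j + w ∈ barlowLayer 1 (Real.sqrt (2 / 3)) σ (k + 1) := by
      obtain ⟨-, hLk1⟩ := barlowBilayer_eq_translate_fcc_of_eq_one 1 (Real.sqrt (2 / 3)) σ k hk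
      have hq : barlowPos 1 (Real.sqrt (2 / 3)) constHagg k i j ∈ barlowLayer 1 (Real.sqrt (2 / 3)) constHagg k := ⟨i, j, rfl⟩
      obtain ⟨-, hpc, -⟩ := fccLayer_add_slot_mem hq hw
      rw [barlowPos_eq_translate_fcc 1 (Real.sqrt (2 / 3)) σ k i j, hLk1]
      exact ⟨_, hpc hw2, by beta_reduce; abel⟩
    have hlow := barlowLayer_sub_two_normal σ k hlab hup
    have hmem := hX _ (barlowLayer_subset_stacking σ (k - 1) hlow) (by
      rw [dist_eq_norm]
      have e : barlowPos 1 (Real.sqrt (2 / 3)) σ k i j + w - (2 * Real.sqrt (2 / 3)) • EuclideanSpace.single (2 : Fin 3) (1 : ℝ) -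
          barlowPos 1 (Real.sqrt (2 / 3)) σ k i j = w - (2 * Real.sqrt (2 / 3)) • EuclideanSpace.single (2 : Fin 3) (1 : ℝ) := by
        abel
      rw [e]
      -- `‖w − 2√(2/3) e₃‖ = 1`: the lowered upper slot is a unit vector (third coordinate `−√(2/3)`, same lateral part)
      have hsq : ‖w - (2 * Real.sqrt (2 / 3)) • EuclideanSpace.single (2 : Fin 3) (1 : ℝ)‖ ^ 2 = 1 := by
        have hw1 : ‖w‖ = 1 := norm_eq_one_of_mem_fccSlots hw
        have hwe : ⟪w, EuclideanSpace.single (2 : Fin 3) (1 : ℝ)⟫_ℝ = w 2 := by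
          rw [EuclideanSpace.inner_single_right]; simp
        rw [norm_sub_sq_real, real_inner_smul_right, norm_smul, hw1, hwe, hw2, he, mul_one, Real.norm_eq_abs,
          abs_of_pos (by positivity)]
        ring
      nlinarith [norm_nonneg (w - (2 * Real.sqrt (2 / 3)) • EuclideanSpace.single (2 : Fin 3) (1 : ℝ)), hsq])
    rw [map_sub, map_add, LinearIsometryEquiv.map_smul] at hmem
    convert hmem using 1
    abel

/-- **CAP-START on a ∇-bilayer of a moved Barlow plate (2-level state).**  `σ k = −1`, `p₀ = barlowPos σ k i j`
(layer `k`), the stacking sites within distance `1` of `p₀` occupied after the motion, `v` an upper model slot with `L v`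
steep for `z`, `G = twinFrame L (L e₃)` the ∇ frame, `q = bestCapper G (L e₃) z`.  Then
`(L p₀ + s₀ + G q, [⟨G, q, L e₃⟩, ⟨L, v, 0⟩])` satisfies `WalkInv` and `StackWF`. -/
theorem walkInv_capStart₂_barlow {z v : EuclideanSpace ℝ (Fin 3)} (hz : ‖z‖ = 1) (hk : σ k = -1)
    (hX : ∀ q ∈ barlowStacking 1 (Real.sqrt (2 / 3)) σ, dist q (barlowPos 1 (Real.sqrt (2 / 3)) σ k i j) ≤ 1 → L q + s₀ ∈ X)
    (hv : v ∈ fccSlots) (hv2 : v 2 = Real.sqrt (2 / 3)) (hsteep : Real.sqrt 2 / 2 ≤ ⟪L v, z⟫_ℝ) :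
    WalkInv X z (L (barlowPos 1 (Real.sqrt (2 / 3)) σ k i j) + s₀ +
        twinFrame L (L (EuclideanSpace.single (2 : Fin 3) (1 : ℝ)))
          (bestCapper (twinFrame L (L (EuclideanSpace.single (2 : Fin 3) (1 : ℝ)))) (L (EuclideanSpace.single (2 : Fin 3) (1 : ℝ))) z),
      [⟨twinFrame L (L (EuclideanSpace.single (2 : Fin 3) (1 : ℝ))),
        bestCapper (twinFrame L (L (EuclideanSpace.single (2 : Fin 3) (1 : ℝ)))) (L (EuclideanSpace.single (2 : Fin 3) (1 : ℝ))) z,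
        L (EuclideanSpace.single (2 : Fin 3) (1 : ℝ))⟩, ⟨L, v, 0⟩]) ∧
    StackWF z [⟨twinFrame L (L (EuclideanSpace.single (2 : Fin 3) (1 : ℝ))),
        bestCapper (twinFrame L (L (EuclideanSpace.single (2 : Fin 3) (1 : ℝ)))) (L (EuclideanSpace.single (2 : Fin 3) (1 : ℝ))) z,
        L (EuclideanSpace.single (2 : Fin 3) (1 : ℝ))⟩, ⟨L, v, 0⟩] := by
  have he : ‖EuclideanSpace.single (2 : Fin 3) (1 : ℝ)‖ = 1 := by rw [PiLp.norm_single, norm_one]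
  have hn : ‖L (EuclideanSpace.single (2 : Fin 3) (1 : ℝ))‖ = 1 := by rw [LinearIsometryEquiv.norm_map, he]
  have hp : L (barlowPos 1 (Real.sqrt (2 / 3)) σ k i j) + s₀ ∈ X := by
    have := hX _ (barlowPos_mem k i j) (by rw [dist_self]; norm_num)
    exact this
  refine walkInv_capStart₂ L _ hz hn (fun w hw => ?_) (fun x => twinFrame_apply L hn x) hv (by rw [inner_frame_axis, hv2])
    hsteep hp (fun w hw h0 => ?_)
  · rw [inner_frame_axis]; exact slot_apply_two_cases hw
  · rw [twinFrame_axis_apply, inner_frame_axis, basalMirror_apply_two_aux] at h0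
    rw [twinFrame_axis_apply]
    rcases barlow_nabla_add_slot_mem σ k i j hk hw (by linarith) with h | h
    · exact mem_of_site hX (by rw [LinearIsometryEquiv.norm_map, norm_eq_one_of_mem_fccSlots hw]) h
    · exact mem_of_site hX (by rw [LinearIsometryEquiv.norm_map, norm_eq_one_of_mem_fccSlots hw]) h

/-- **Strong certificate, ∇ over a ∇-step** (`σ k = −1`, `σ (k−1) = −1`: the predecessor carries its full `G`-dozen),
for any `G`-positive direction slot `q` (e.g. `bestCapper G (L e₃) z`) and any entry normal `m`. -/
theorem walkCertified12_capStart₂_barlow_cc {q m : EuclideanSpace ℝ (Fin 3)} (hk : σ k = -1) (hk' : σ (k - 1) = -1)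
    (hX : ∀ q ∈ barlowStacking 1 (Real.sqrt (2 / 3)) σ, dist q (barlowPos 1 (Real.sqrt (2 / 3)) σ k i j) ≤ 1 → L q + s₀ ∈ X) :
    WalkCertified12 X (L (barlowPos 1 (Real.sqrt (2 / 3)) σ k i j) + s₀ +
        twinFrame L (L (EuclideanSpace.single (2 : Fin 3) (1 : ℝ))) q)
      ⟨twinFrame L (L (EuclideanSpace.single (2 : Fin 3) (1 : ℝ))), q, m⟩ := by
  have hp : L (barlowPos 1 (Real.sqrt (2 / 3)) σ k i j) + s₀ ∈ X := by
    have := hX _ (barlowPos_mem k i j) (by rw [dist_self]; norm_num)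
    exact this
  refine walkCertified12_of_full _ hp fun w hw => ?_
  rw [twinFrame_axis_apply]
  have hnorm : ‖basalMirror w‖ ≤ 1 := by rw [LinearIsometryEquiv.norm_map, norm_eq_one_of_mem_fccSlots hw]
  rcases slot_apply_two_cases hw with h | h | h
  · rcases barlow_nabla_add_slot_mem σ k i j hk hw h.le with h' | h'
    · exact mem_of_site hX hnorm h'
    · exact mem_of_site hX hnorm h'
  · exact mem_of_site hX hnorm (barlow_nabla_sub_slot_mem σ k i j hk' hw h)
  · rcases barlow_nabla_add_slot_mem σ k i j hk hw (by rw [h]; exact neg_nonpos.2 (Real.sqrt_nonneg _)) with h' | h'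
    · exact mem_of_site hX hnorm h'
    · exact mem_of_site hX hnorm h'

/-- **Strong certificate, ∇ over a Δ-step** (`σ k = −1`, `σ (k−1) = 1`: the predecessor carries its full TWIN dozen for
`(G, L e₃)` — the `G`-positive slots lowered by two spacings are layer `k − 1`), for a `G`-positive direction `q`. -/
theorem walkCertified12_capStart₂_barlow_hc {q m : EuclideanSpace ℝ (Fin 3)} (hk : σ k = -1) (hk' : σ (k - 1) = 1)
    (hX : ∀ q ∈ barlowStacking 1 (Real.sqrt (2 / 3)) σ, dist q (barlowPos 1 (Real.sqrt (2 / 3)) σ k i j) ≤ 1 → L q + s₀ ∈ X)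
    (hq : 0 < ⟪twinFrame L (L (EuclideanSpace.single (2 : Fin 3) (1 : ℝ))) q, L (EuclideanSpace.single (2 : Fin 3) (1 : ℝ))⟫_ℝ) :
    WalkCertified12 X (L (barlowPos 1 (Real.sqrt (2 / 3)) σ k i j) + s₀ +
        twinFrame L (L (EuclideanSpace.single (2 : Fin 3) (1 : ℝ))) q)
      ⟨twinFrame L (L (EuclideanSpace.single (2 : Fin 3) (1 : ℝ))), q, m⟩ := by
  have he : ‖EuclideanSpace.single (2 : Fin 3) (1 : ℝ)‖ = 1 := by rw [PiLp.norm_single, norm_one]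
  have hn : ‖L (EuclideanSpace.single (2 : Fin 3) (1 : ℝ))‖ = 1 := by rw [LinearIsometryEquiv.norm_map, he]
  have hp : L (barlowPos 1 (Real.sqrt (2 / 3)) σ k i j) + s₀ ∈ X := by
    have := hX _ (barlowPos_mem k i j) (by rw [dist_self]; norm_num)
    exact this
  have hlab : haggLabel σ (k + 1) = haggLabel σ (k - 1) := haggLabel_eq_of_hLayer σ k (by rw [hk, hk']; ring)
  have hmenuL : ∀ w ∈ fccSlots, ⟪L w, L (EuclideanSpace.single (2 : Fin 3) (1 : ℝ))⟫_ℝ = 0 ∨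
      ⟪L w, L (EuclideanSpace.single (2 : Fin 3) (1 : ℝ))⟫_ℝ = Real.sqrt (2 / 3) ∨
      ⟪L w, L (EuclideanSpace.single (2 : Fin 3) (1 : ℝ))⟫_ℝ = -Real.sqrt (2 / 3) := fun w hw => by
    rw [inner_frame_axis]; exact slot_apply_two_cases hw
  have hmenuG := menu_reflect L (twinFrame L (L (EuclideanSpace.single (2 : Fin 3) (1 : ℝ)))) hn hmenuL
    (fun x => twinFrame_apply L hn x)
  refine walkCertified12_of_twinDozen _ hn hmenuG hq hp (fun w hw h0 => ?_) (fun w hw h0 => ?_)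
  · rw [twinFrame_axis_apply, inner_frame_axis, basalMirror_apply_two_aux] at h0
    rw [twinFrame_axis_apply]
    have hnorm : ‖basalMirror w‖ ≤ 1 := by rw [LinearIsometryEquiv.norm_map, norm_eq_one_of_mem_fccSlots hw]
    rcases barlow_nabla_add_slot_mem σ k i j hk hw (by linarith) with h | h
    · exact mem_of_site hX hnorm h
    · exact mem_of_site hX hnorm h
  · rw [twinFrame_axis_apply, inner_frame_axis, basalMirror_apply_two_aux] at h0
    rw [twinFrame_axis_apply]
    have hw2 : w 2 = -Real.sqrt (2 / 3) := by
      rcases slot_apply_two_cases hw with h | h | h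
      · rw [h] at h0; simp at h0
      · rw [h] at h0; have := Real.sqrt_nonneg (2 / 3); linarith
      · exact h
    -- `p₀ + basalMirror w` is in layer `k+1`; lowered by two spacings it is in layer `k−1`
    have hup : barlowPos 1 (Real.sqrt (2 / 3)) σ k i j + basalMirror w ∈ barlowLayer 1 (Real.sqrt (2 / 3)) σ (k + 1) := by
      obtain ⟨-, hLk1⟩ := barlowBilayer_eq_mirror_translate_fcc_of_eq_neg_one 1 (Real.sqrt (2 / 3)) σ k hk
      have hq' : barlowPos 1 (Real.sqrt (2 / 3)) constHagg (-k) i j ∈ barlowLayer 1 (Real.sqrt (2 / 3)) constHagg (-k) :=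
        ⟨i, j, rfl⟩
      obtain ⟨-, -, hnc⟩ := fccLayer_add_slot_mem hq' hw
      rw [barlowPos_eq_mirror_translate_fcc 1 (Real.sqrt (2 / 3)) σ k i j, hLk1, show -(k + 1) = -k - 1 by ring]
      exact ⟨_, hnc hw2, by beta_reduce; rw [map_add]; abel⟩
    have hlow := barlowLayer_sub_two_normal σ k hlab hup
    have hmem := hX _ (barlowLayer_subset_stacking σ (k - 1) hlow) (by
      rw [dist_eq_norm]
      have e : barlowPos 1 (Real.sqrt (2 / 3)) σ k i j + basalMirror w -
          (2 * Real.sqrt (2 / 3)) • EuclideanSpace.single (2 : Fin 3) (1 : ℝ) - barlowPos 1 (Real.sqrt (2 / 3)) σ k i j =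
          basalMirror w - (2 * Real.sqrt (2 / 3)) • EuclideanSpace.single (2 : Fin 3) (1 : ℝ) := by
        abel
      rw [e]
      have hsq : ‖basalMirror w - (2 * Real.sqrt (2 / 3)) • EuclideanSpace.single (2 : Fin 3) (1 : ℝ)‖ ^ 2 = 1 := by
        have hw1 : ‖basalMirror w‖ = 1 := by rw [LinearIsometryEquiv.norm_map, norm_eq_one_of_mem_fccSlots hw]
        have hwe : ⟪basalMirror w, EuclideanSpace.single (2 : Fin 3) (1 : ℝ)⟫_ℝ = Real.sqrt (2 / 3) := by
          rw [EuclideanSpace.inner_single_right, basalMirror_apply_two_aux, hw2]; simp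
        rw [norm_sub_sq_real, real_inner_smul_right, norm_smul, hw1, hwe, he, mul_one, Real.norm_eq_abs,
          abs_of_pos (by positivity)]
        ring
      nlinarith [norm_nonneg (basalMirror w - (2 * Real.sqrt (2 / 3)) • EuclideanSpace.single (2 : Fin 3) (1 : ℝ)), hsq])
    rw [map_sub, map_add, LinearIsometryEquiv.map_smul] at hmem
    convert hmem using 1
    abel

end Moved

end Summit.Ventures.Crystal3D.Theorems

end
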